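import Summits.MatrixMultiplication.MatrixMultiplication.Theorems.SoloInformedTwoRows

/-!
# Two rows of `b` constant on a common column set — unified form (every chart)

This work, §8.8 (T12) (gen 107), THEOREM 8.17. `signEq_of_mem_inter₃` is the general two-centre intersection lemma:
two inequivalent elements whose classes lie in `{[α + v], [α - v]} ∩ {[α' + v'], [α' - v']}` force
`(v ~ v' ∧ α ~ α') ∨ (v ~ α' ∧ v' ~ α)`. Consequently (`Data.card_mul_le_of_two_rows_gen`) two rows `j`, `j'` of
`b` that are class-constant on a common column set `K*` (classes `v`, `v'`, equivalent OR NOT) pay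
`n · |I₁| · |K*| ≤ r · |S⁰|` for every `I₁` avoiding `{i : (v ~ v' ∧ a i j ~ a i j') ∨ (v ~ a i j' ∧ v' ~ a i j)}`; for
`v ~ v'` (THEOREM 8.17: two AGREEING constant rows) the exceptional rows are exactly those where the columns `j`,
`j'` of `a` agree. References: this work §8.8; CohnUmans2013 Def. 12.
-/

namespace Summit.MatrixMultiplication.MatrixMultiplication.Theorems.TwistedTPP

namespace FibreLines

variable {ι G : Type*} [AddCommGroup G]

/-- **General two-centre intersection lemma.** [this work, §8.8 (T12)] -/
theorem signEq_of_mem_inter₃ (hG : ∀ x : G, x = -x → x = 0) {α α' v v' y y' : G}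
    (hex₁ : ¬ (SignEq v v' ∧ SignEq α α')) (hex : ¬ (SignEq v α' ∧ SignEq v' α))
    (hy : SignEq y (α + v) ∨ SignEq y (α - v)) (hz : SignEq y (α' + v') ∨ SignEq y (α' - v'))
    (hy' : SignEq y' (α + v) ∨ SignEq y' (α - v)) (hz' : SignEq y' (α' + v') ∨ SignEq y' (α' - v')) :
    SignEq y y' := by
  by_contra hne
  have key : ∀ {a b : G}, SignEq y (α + a) → SignEq y' (α - a) → SignEq y (α' + b) → SignEq y' (α' - b) →
      (SignEq a b ∧ SignEq α α') ∨ (SignEq a α' ∧ SignEq b α) := by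
    intro a b ha ha' hb hb'
    exact signEq_pair_of_signEq_add_sub hG (ha.symm.trans hb) (ha'.symm.trans hb')
  have np : ∀ {u : G}, SignEq y u → SignEq y' u → False := fun ha ha' => hne (ha.trans ha'.symm)
  have finpp : (SignEq v v' ∧ SignEq α α') ∨ (SignEq v α' ∧ SignEq v' α) → False := fun h => h.elim hex₁ hex
  have finpm : (SignEq v (-v') ∧ SignEq α α') ∨ (SignEq v α' ∧ SignEq (-v') α) → False := by
    rintro (⟨h, h'⟩ | ⟨h1, h2⟩)
    · exact hex₁ ⟨signEq_neg_right.mp h, h'⟩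
    · exact hex ⟨h1, signEq_neg_left.mp h2⟩
  have finmp : (SignEq (-v) v' ∧ SignEq α α') ∨ (SignEq (-v) α' ∧ SignEq v' α) → False := by
    rintro (⟨h, h'⟩ | ⟨h1, h2⟩)
    · exact hex₁ ⟨signEq_neg_left.mp h, h'⟩
    · exact hex ⟨signEq_neg_left.mp h1, h2⟩
  have finmm : (SignEq (-v) (-v') ∧ SignEq α α') ∨ (SignEq (-v) α' ∧ SignEq (-v') α) → False := by
    rintro (⟨h, h'⟩ | ⟨h1, h2⟩)
    · exact hex₁ ⟨signEq_neg_left.mp (signEq_neg_right.mp h), h'⟩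
    · exact hex ⟨signEq_neg_left.mp h1, signEq_neg_left.mp h2⟩
  rcases hy with hy | hy <;> rcases hy' with hy' | hy' <;> rcases hz with hz | hz <;>
    rcases hz' with hz' | hz'
  · exact np hy hy'
  · exact np hy hy'
  · exact np hy hy'
  · exact np hy hy'
  · exact np hz hz'
  · exact finpp (key (a := v) (b := v') hy hy' hz hz')
  · exact finpm (key (a := v) (b := (-v')) hy hy' (by rw [← sub_eq_add_neg]; exact hz) (by rw [sub_neg_eq_add]; exact hz'))
  · exact np hz hz'
  · exact np hz hz'
  · exact finmp (key (a := (-v)) (b := v') (by rw [← sub_eq_add_neg]; exact hy) (by rw [sub_neg_eq_add]; exact hy') hz hz')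
  · exact finmm (key (a := (-v)) (b := (-v')) (by rw [← sub_eq_add_neg]; exact hy) (by rw [sub_neg_eq_add]; exact hy') (by rw [← sub_eq_add_neg]; exact hz) (by rw [sub_neg_eq_add]; exact hz'))
  · exact np hz hz'
  · exact np hy hy'
  · exact np hy hy'
  · exact np hy hy'
  · exact np hy hy'

variable {G₀ R : Type*} [AddCommGroup G₀]

/-- **THEOREM 8.16/8.17 unified (two constant rows of `b` on a common column set, every chart).**
[this work, §8.8 (T12)] -/
theorem Data.card_mul_le_of_two_rows_gen [Fintype ι] [DecidableEq ι] [Fintype G₀] [DecidableEq G₀]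
    [Fintype R] [DecidableEq R] (hG : ∀ x : G, x = -x → x = 0) (D : Data ι G) (Φ : Chart ι G₀) (κ : G → R)
    (hκ : ∀ x y, κ x = κ y → SignEq x y) (hsep : D.SepAll Φ) {j j' : ι} {v v' : G}
    (I₁ Ks : Finset ι) (hj : ∀ k ∈ Ks, SignEq (D.b j k) v) (hj' : ∀ k ∈ Ks, SignEq (D.b j' k) v')
    (hI₁ : ∀ i ∈ I₁, ¬ (SignEq v v' ∧ SignEq (D.a i j) (D.a i j')))
    (hI : ∀ i ∈ I₁, ¬ (SignEq v (D.a i j') ∧ SignEq v' (D.a i j))) :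
    Fintype.card ι * I₁.card * Ks.card ≤ Fintype.card R * Fintype.card G₀ := by
  refine D.card_mul_le_of_c_colsOn₂ Φ κ hκ hsep I₁ Ks ?_
  intro k hk k'' hk'' i hi
  have e1 : ∀ k ∈ Ks, SignEq (D.c k i) (D.a i j + v) ∨ SignEq (D.c k i) (D.a i j - v) := fun k hk =>
    ((D.adm_eqn i j k).of_signEq_mid (hj k hk)).signEq_add_or_sub
  have e2 : ∀ k ∈ Ks, SignEq (D.c k i) (D.a i j' + v') ∨ SignEq (D.c k i) (D.a i j' - v') := fun k hk =>
    ((D.adm_eqn i j' k).of_signEq_mid (hj' k hk)).signEq_add_or_sub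
  exact signEq_of_mem_inter₃ hG (hI₁ i hi) (hI i hi) (e1 k'' hk'') (e2 k'' hk'') (e1 k hk) (e2 k hk)

/-- **THEOREM 8.17 (two AGREEING constant rows of `b`).** If rows `j`, `j'` of `b` are both of class `[v]` on
`K*`, then `n · |D| · |K*| ≤ r · |S⁰|` for every `D ⊆ {i : a i j ≁ a i j'}`. [this work, §8.8 (T12)] -/
theorem Data.card_mul_le_of_two_rows_agree [Fintype ι] [DecidableEq ι] [Fintype G₀] [DecidableEq G₀]
    [Fintype R] [DecidableEq R] (hG : ∀ x : G, x = -x → x = 0) (D : Data ι G) (Φ : Chart ι G₀) (κ : G → R)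
    (hκ : ∀ x y, κ x = κ y → SignEq x y) (hsep : D.SepAll Φ) {j j' : ι} {v : G}
    (I₁ Ks : Finset ι) (hj : ∀ k ∈ Ks, SignEq (D.b j k) v) (hj' : ∀ k ∈ Ks, SignEq (D.b j' k) v)
    (hI : ∀ i ∈ I₁, ¬ SignEq (D.a i j) (D.a i j')) :
    Fintype.card ι * I₁.card * Ks.card ≤ Fintype.card R * Fintype.card G₀ :=
  D.card_mul_le_of_two_rows_gen hG Φ κ hκ hsep I₁ Ks hj hj' (fun i hi h => hI i hi h.2)
    (fun i hi h => hI i hi (h.2.symm.trans h.1))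

end FibreLines

end Summit.MatrixMultiplication.MatrixMultiplication.Theorems.TwistedTPP
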